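import Summits.QuantumFields.YangMills.Theorems.AllWindowsColdBoxBoxHighLineSmearedFPOperatorPerturbation
import Summits.QuantumFields.YangMills.Theorems.AllWindowsColdBoxBoxHighLineStep2Defs

/-!
# T-S5.7d input: the Faddeev–Popov operator as an ℝ-LINEAR function of the link matrices (`GhostFP.fpGen`), locality and entry bounds
# (STUB-PLAN-S5-STEP2 §8, planner ym-idea-2 g18 routing 2026-08-29T19:46:09Z (iii) `GhostTaylor`; LINE-19 S5 ⟨stmt-QuantumFields-24004⟩/⟨24335⟩)

Width seat `ym-line-sfw-p2-w3` (g40).  The lattice Faddeev–Popov operator ✓`fpOperator H U` (w2 g30, ✓`…SmearedFPOperator`) has entries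
`divDefectLin U θ_q x c` with `pauliLinkLin U θ e = X(θ_{e₋})·U_e − U_e·X(θ_{e₊})` — it is ℝ-LINEAR in the link matrices `U_e ∈ M₂(ℂ)`.  For the
Taylor expansion of `log |det F(U(a))|` in the edge chart (T-S5.7d) the perturbation `F(U(a)) − F(1)` must be split into its linear, quadratic
and higher parts in `a`, which are NOT Faddeev–Popov operators of `SU(2)` configurations; this file therefore types the same formula for an
arbitrary matrix-valued link field `W : ZdEdge 4 → M₂(ℂ)`:

* `GhostFP.linkLinM W a e`, `GhostFP.divLinM W a x`, `GhostFP.basisField H q` (the site field of the coordinate vector `e_q`), and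
  **`GhostFP.fpGen H W`** with `fpOperator H U = fpGen H (↑U)` (`fpOperator_eq_fpGen`);
* ℝ-linearity in `W` (`fpGen_add/_sub/_smul/_zero/_sum`) and LOCALITY (`fpGen_congr`: only the cold-box links enter);
* the ENTRY BOUND `|fpGen H W (x,c) (y,b)| ≤ 3δ · nbW x y` when `‖W_e‖ ≤ δ` on the box links (`abs_fpGen_le`), with the explicit nearest-neighbour
  weight `nbW x y = Σ_μ ([x−e_μ = y] + [x+e_μ = y] + 2[x = y])` (`≤ 16`, row and column sums `≤ 16`, vanishing unless `y` is `x` or a lattice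
  neighbour of `x`).

Everything proved; four bookkeeping definitions; standard axioms.  HONEST LABEL: an input of ONE brick (7d) of STEP 2 of the XL stub S5 of a
critic-PASSed DRAFT line; 7d, S5, U5, ⟨24004⟩ ⟨24335⟩ ⟨24336⟩ remain OPEN; no crux, rung or summit is proved; **the Yang–Mills mass gap is NOT
proved by this file.**
-/

set_option autoImplicit false

noncomputable section

open Matrix Finset
open scoped Matrix.Norms.Operator
open Literature.MathematicalPhysics.QuantumFieldTheory.Balaban1983to89.B10Eq18SigmaSU2 (su2Coord)
open Literature.MathematicalPhysics.QuantumFieldTheory.AxialGauge (boxEdges)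
open Literature.MathematicalPhysics.QuantumLattice (LGConfig ZdEdge)
open Literature.Probability.LatticeModels (Site)

namespace Summit.QuantumFields.YangMills.Theorems.AllWindowsColdBoxBoxHighLine

namespace GhostFP

open LandauBall (in_mem_boxEdges out_mem_boxEdges)

variable {H : ℕ}

/-! ## The generalized operator -/

/-- Link variation with a general matrix-valued link field: `X(a_{e₋})·W_e − W_e·X(a_{e₊})`. -/
def linkLinM (W : ZdEdge 4 → Matrix (Fin 2) (Fin 2) ℂ) (a : Site 4 → E3) (e : ZdEdge 4) : Matrix (Fin 2) (Fin 2) ℂ :=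
  su2Coord (a e.1) * W e - W e * su2Coord (a (e.1 + Pi.single e.2 1))

/-- Linearised divergence defect with a general matrix-valued link field. -/
def divLinM (W : ZdEdge 4 → Matrix (Fin 2) (Fin 2) ℂ) (a : Site 4 → E3) (x : Site 4) : Fin 3 → ℝ :=
  ∑ μ : Fin 4, (imVecM (linkLinM W a (x - Pi.single μ 1, μ)) - imVecM (linkLinM W a (x, μ)))

/-- The site field of the coordinate vector `e_q` (`q = (y, b)`): `e_b` at `y`, zero elsewhere. -/
def basisField (H : ℕ) (q : ↥(interiorSites H) × Fin 3) : Site 4 → E3 := extPauli H (vecToField H (Pi.single q 1))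

/-- **The Faddeev–Popov matrix of a general link field** `W : ZdEdge 4 → M₂(ℂ)` (same formula as ✓`fpOperator`). -/
def fpGen (H : ℕ) (W : ZdEdge 4 → Matrix (Fin 2) (Fin 2) ℂ) :
    Matrix (↥(interiorSites H) × Fin 3) (↥(interiorSites H) × Fin 3) ℝ :=
  Matrix.of fun p q => divLinM W (basisField H q) p.1 p.2

/-- Entries of `fpGen`. -/
theorem fpGen_apply (W : ZdEdge 4 → Matrix (Fin 2) (Fin 2) ℂ) (p q : ↥(interiorSites H) × Fin 3) :
    fpGen H W p q = divLinM W (basisField H q) p.1 p.2 := rfl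

/-- **`fpOperator H U = fpGen H ↑U`.** -/
theorem fpOperator_eq_fpGen (U : LGConfig 4 SU2) : fpOperator H U = fpGen H (fun e => (U e : Matrix (Fin 2) (Fin 2) ℂ)) := by
  ext p q
  rw [fpOperator_apply, fpGen_apply]
  rfl

/-! ## ℝ-linearity in the link field -/

/-- `linkLinM` is additive in `W`. -/
theorem linkLinM_add (W W' : ZdEdge 4 → Matrix (Fin 2) (Fin 2) ℂ) (a : Site 4 → E3) (e : ZdEdge 4) :
    linkLinM (W + W') a e = linkLinM W a e + linkLinM W' a e := by
  simp only [linkLinM, Pi.add_apply, mul_add, add_mul]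
  abel

/-- `linkLinM` is ℝ-homogeneous in `W`. -/
theorem linkLinM_smul (r : ℝ) (W : ZdEdge 4 → Matrix (Fin 2) (Fin 2) ℂ) (a : Site 4 → E3) (e : ZdEdge 4) :
    linkLinM (r • W) a e = r • linkLinM W a e := by
  simp only [linkLinM, Pi.smul_apply, mul_smul_comm, smul_mul_assoc, smul_sub]

/-- `divLinM` is additive in `W`. -/
theorem divLinM_add (W W' : ZdEdge 4 → Matrix (Fin 2) (Fin 2) ℂ) (a : Site 4 → E3) (x : Site 4) :
    divLinM (W + W') a x = divLinM W a x + divLinM W' a x := by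
  simp only [divLinM, linkLinM_add, imVecM_add, ← Finset.sum_add_distrib]
  exact Finset.sum_congr rfl fun μ _ => by abel

/-- `divLinM` is ℝ-homogeneous in `W`. -/
theorem divLinM_smul (r : ℝ) (W : ZdEdge 4 → Matrix (Fin 2) (Fin 2) ℂ) (a : Site 4 → E3) (x : Site 4) :
    divLinM (r • W) a x = r • divLinM W a x := by
  simp only [divLinM, linkLinM_smul, imVecM_smul, Finset.smul_sum, smul_sub]

/-- **`fpGen` is additive.** -/
theorem fpGen_add (W W' : ZdEdge 4 → Matrix (Fin 2) (Fin 2) ℂ) : fpGen H (W + W') = fpGen H W + fpGen H W' := by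
  ext p q
  simp only [fpGen_apply, Matrix.add_apply, divLinM_add, Pi.add_apply]

/-- **`fpGen` is ℝ-homogeneous.** -/
theorem fpGen_smul (r : ℝ) (W : ZdEdge 4 → Matrix (Fin 2) (Fin 2) ℂ) : fpGen H (r • W) = r • fpGen H W := by
  ext p q
  simp only [fpGen_apply, Matrix.smul_apply, divLinM_smul, Pi.smul_apply]

/-- `fpGen 0 = 0`. -/
theorem fpGen_zero : fpGen H (0 : ZdEdge 4 → Matrix (Fin 2) (Fin 2) ℂ) = 0 := by
  have h := fpGen_smul (H := H) 0 (0 : ZdEdge 4 → Matrix (Fin 2) (Fin 2) ℂ)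
  rwa [zero_smul, zero_smul] at h

/-- `fpGen` is subtractive. -/
theorem fpGen_sub (W W' : ZdEdge 4 → Matrix (Fin 2) (Fin 2) ℂ) : fpGen H (W - W') = fpGen H W - fpGen H W' := by
  rw [sub_eq_add_neg, fpGen_add, show -W' = (-1 : ℝ) • W' by simp, fpGen_smul]
  simp [sub_eq_add_neg]

/-- `fpGen` over finite sums. -/
theorem fpGen_sum {ι : Type*} (s : Finset ι) (W : ι → ZdEdge 4 → Matrix (Fin 2) (Fin 2) ℂ) :
    fpGen H (∑ i ∈ s, W i) = ∑ i ∈ s, fpGen H (W i) := by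
  classical
  induction s using Finset.induction_on with
  | empty => simp [fpGen_zero]
  | insert i s hi ih => rw [Finset.sum_insert hi, Finset.sum_insert hi, fpGen_add, ih]

/-! ## Locality: only the cold-box links enter -/

/-- The entry `(x,c),(y,b)` written out: the eight links at the interior site `x`. -/
theorem fpGen_apply_eq_sum (W : ZdEdge 4 → Matrix (Fin 2) (Fin 2) ℂ) (p q : ↥(interiorSites H) × Fin 3) :
    fpGen H W p q = ∑ μ : Fin 4, (imVecM (linkLinM W (basisField H q) ((p.1 : Site 4) - Pi.single μ 1, μ)) p.2 -
      imVecM (linkLinM W (basisField H q) ((p.1 : Site 4), μ)) p.2) := by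
  rw [fpGen_apply, divLinM, Finset.sum_apply]
  rfl

/-- **Locality**: two link fields that agree on the cold-box links have the same Faddeev–Popov matrix. -/
theorem fpGen_congr {W W' : ZdEdge 4 → Matrix (Fin 2) (Fin 2) ℂ} (h : ∀ e ∈ boxEdges 4 (2 * H + 1), W e = W' e) :
    fpGen H W = fpGen H W' := by
  ext p q
  rw [fpGen_apply_eq_sum, fpGen_apply_eq_sum]
  refine Finset.sum_congr rfl fun μ _ => ?_
  simp only [linkLinM, h _ (in_mem_boxEdges p.1.2 μ), h _ (out_mem_boxEdges p.1.2 μ)]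

/-! ## The basis site field and the nearest-neighbour weight -/

/-- `‖basisField H q z‖ = [z = q.1]`. -/
theorem norm_basisField (q : ↥(interiorSites H) × Fin 3) (z : Site 4) :
    ‖basisField H q z‖ = if z = (q.1 : Site 4) then 1 else 0 := by
  unfold basisField
  by_cases hz : z ∈ interiorSites H
  · rw [extPauli_of_mem _ hz]
    by_cases hzq : z = (q.1 : Site 4)
    · rw [if_pos hzq]
      have hy : (⟨z, hz⟩ : ↥(interiorSites H)) = q.1 := Subtype.ext hzq
      rw [hy]
      have hcomp : ∀ b, (vecToField H (Pi.single q (1 : ℝ)) q.1) b = if b = q.2 then 1 else 0 := by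
        intro b
        rw [vecToField_apply, Pi.single_apply]
        by_cases hb : b = q.2
        · subst hb; simp
        · have : (q.1, b) ≠ q := fun h => hb (congrArg Prod.snd h)
          simp [hb, this]
      have hsq : ‖vecToField H (Pi.single q (1 : ℝ)) q.1‖ ^ 2 = 1 := by
        rw [EuclideanSpace.norm_sq_eq]
        simp only [hcomp, Real.norm_eq_abs, sq_abs]
        simp [Finset.sum_ite_eq']
      have h0 := norm_nonneg (vecToField H (Pi.single q (1 : ℝ)) q.1)
      nlinarith [hsq, h0]
    · rw [if_neg hzq]
      have hv : vecToField H (Pi.single q (1 : ℝ)) ⟨z, hz⟩ = 0 := by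
        ext b
        rw [vecToField_apply, Pi.single_apply]
        have : ((⟨z, hz⟩ : ↥(interiorSites H)), b) ≠ q := fun h => hzq (by rw [← h])
        simp [this]
      rw [hv, norm_zero]
  · rw [extPauli_of_not_mem _ hz, norm_zero]
    have hzq : z ≠ (q.1 : Site 4) := fun h => hz (h ▸ q.1.2)
    rw [if_neg hzq]

/-- The nearest-neighbour weight of the entry bound: `Σ_μ ([x − e_μ = y] + [x + e_μ = y] + 2·[x = y])`. -/
def nbW (x y : Site 4) : ℝ :=
  ∑ μ : Fin 4, ((if x - Pi.single μ 1 = y then (1 : ℝ) else 0) + (if x + Pi.single μ 1 = y then (1 : ℝ) else 0) +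
    2 * (if x = y then (1 : ℝ) else 0))

/-- `0 ≤ nbW x y`. -/
theorem nbW_nonneg (x y : Site 4) : 0 ≤ nbW x y :=
  Finset.sum_nonneg fun μ _ => by
    have h1 : (0 : ℝ) ≤ (if x - Pi.single μ 1 = y then (1 : ℝ) else 0) := by split_ifs <;> norm_num
    have h2 : (0 : ℝ) ≤ (if x + Pi.single μ 1 = y then (1 : ℝ) else 0) := by split_ifs <;> norm_num
    have h3 : (0 : ℝ) ≤ (if x = y then (1 : ℝ) else 0) := by split_ifs <;> norm_num
    linarith

/-- `nbW x y ≤ 16`. -/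
theorem nbW_le (x y : Site 4) : nbW x y ≤ 16 := by
  unfold nbW
  calc _ ≤ ∑ _μ : Fin 4, (4 : ℝ) := Finset.sum_le_sum fun μ _ => by
        have h1 : (if x - Pi.single μ 1 = y then (1 : ℝ) else 0) ≤ 1 := by split_ifs <;> norm_num
        have h2 : (if x + Pi.single μ 1 = y then (1 : ℝ) else 0) ≤ 1 := by split_ifs <;> norm_num
        have h3 : (if x = y then (1 : ℝ) else 0) ≤ 1 := by split_ifs <;> norm_num
        linarith
    _ = 16 := by simp; norm_num

/-- Off the nearest neighbours the weight vanishes: if some coordinate of `x − y` exceeds `1` in absolute value then `nbW x y = 0`. -/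
theorem nbW_eq_zero_of_far {x y : Site 4} (h : ∃ k, 1 < |x k - y k|) : nbW x y = 0 := by
  obtain ⟨k, hk⟩ := h
  unfold nbW
  refine Finset.sum_eq_zero fun μ _ => ?_
  have hs : (Pi.single μ (1 : ℤ) : Site 4) k = if k = μ then 1 else 0 := by
    by_cases hkμ : k = μ
    · subst hkμ; simp
    · simp [hkμ]
  have h1 : ¬ x - Pi.single μ 1 = y := by
    intro hxy
    have := congrFun hxy k
    rw [Pi.sub_apply, hs] at this
    split_ifs at this <;> [(rw [abs_of_pos (by omega)] at hk; omega); (rw [show x k - y k = 0 by omega] at hk; simp at hk)]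
  have h2 : ¬ x + Pi.single μ 1 = y := by
    intro hxy
    have := congrFun hxy k
    rw [Pi.add_apply, hs] at this
    split_ifs at this <;> [(rw [abs_of_neg (by omega)] at hk; omega); (rw [show x k - y k = 0 by omega] at hk; simp at hk)]
  have h3 : ¬ x = y := by
    intro hxy; rw [hxy, sub_self, abs_zero] at hk; exact absurd hk (by norm_num)
  rw [if_neg h1, if_neg h2, if_neg h3]; ring

/-- An indicator of an injective image sums to at most `1` over the interior sites. -/
theorem sum_ite_eq_le_one (f : Site 4 → Site 4) (hf : Function.Injective f) (y : Site 4) :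
    ∑ x : ↥(interiorSites H), (if f (x : Site 4) = y then (1 : ℝ) else 0) ≤ 1 := by
  rw [Finset.sum_boole]
  have h : (Finset.univ.filter fun x : ↥(interiorSites H) => f (x : Site 4) = y).card ≤ 1 := by
    refine Finset.card_le_one.2 fun a ha b hb => ?_
    rw [Finset.mem_filter] at ha hb
    exact Subtype.ext (hf (ha.2.trans hb.2.symm))
  exact_mod_cast h

/-- **Row sums of the weight**: `Σ_{y interior} nbW x y ≤ 16`. -/
theorem sum_nbW_right_le (x : Site 4) : ∑ y : ↥(interiorSites H), nbW x (y : Site 4) ≤ 16 := by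
  have h1 : ∀ z : Site 4, ∑ y : ↥(interiorSites H), (if z = (y : Site 4) then (1 : ℝ) else 0) ≤ 1 := by
    intro z
    have := sum_ite_eq_le_one (H := H) id Function.injective_id z
    simpa [eq_comm] using this
  unfold nbW
  rw [Finset.sum_comm]
  calc _ ≤ ∑ _μ : Fin 4, (4 : ℝ) := Finset.sum_le_sum fun μ _ => by
        rw [Finset.sum_add_distrib, Finset.sum_add_distrib, ← Finset.mul_sum]
        have a1 := h1 (x - Pi.single μ 1)
        have a2 := h1 (x + Pi.single μ 1)
        have a3 := h1 x
        linarith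
    _ = 16 := by simp; norm_num

/-- **Column sums of the weight**: `Σ_{x interior} nbW x y ≤ 16`. -/
theorem sum_nbW_left_le (y : Site 4) : ∑ x : ↥(interiorSites H), nbW (x : Site 4) y ≤ 16 := by
  unfold nbW
  rw [Finset.sum_comm]
  calc _ ≤ ∑ _μ : Fin 4, (4 : ℝ) := Finset.sum_le_sum fun μ _ => by
        rw [Finset.sum_add_distrib, Finset.sum_add_distrib, ← Finset.mul_sum]
        have a1 := sum_ite_eq_le_one (H := H) (fun z => z - Pi.single μ 1) (fun a b h => sub_left_injective h) y
        have a2 := sum_ite_eq_le_one (H := H) (fun z => z + Pi.single μ 1) (fun a b h => add_left_injective _ h) y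
        have a3 := sum_ite_eq_le_one (H := H) (fun z => z) (fun a b h => h) y
        beta_reduce at a1 a2 a3
        linarith
    _ = 16 := by simp; norm_num

/-! ## The entry bound -/

/-- Norm of the generalized link variation: `‖X(a_{e₋})W_e − W_e X(a_{e₊})‖ ≤ 3‖W_e‖(‖a_{e₋}‖ + ‖a_{e₊}‖)`. -/
theorem norm_linkLinM_le (W : ZdEdge 4 → Matrix (Fin 2) (Fin 2) ℂ) (a : Site 4 → E3) (e : ZdEdge 4) :
    ‖linkLinM W a e‖ ≤ 3 * ‖W e‖ * (‖a e.1‖ + ‖a (e.1 + Pi.single e.2 1)‖) := by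
  unfold linkLinM
  calc _ ≤ ‖su2Coord (a e.1) * W e‖ + ‖W e * su2Coord (a (e.1 + Pi.single e.2 1))‖ := norm_sub_le _ _
    _ ≤ 3 * ‖a e.1‖ * ‖W e‖ + ‖W e‖ * (3 * ‖a (e.1 + Pi.single e.2 1)‖) :=
        add_le_add ((norm_mul_le _ _).trans (mul_le_mul_of_nonneg_right (Parity.norm_su2Coord_le _) (norm_nonneg _)))
          ((norm_mul_le _ _).trans (mul_le_mul_of_nonneg_left (Parity.norm_su2Coord_le _) (norm_nonneg _)))
    _ = 3 * ‖W e‖ * (‖a e.1‖ + ‖a (e.1 + Pi.single e.2 1)‖) := by ring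

/-- **The entry bound**: if `‖W_e‖ ≤ δ` on the cold-box links then `|fpGen H W (x,c) (y,b)| ≤ 3δ · nbW x y`. -/
theorem abs_fpGen_le (W : ZdEdge 4 → Matrix (Fin 2) (Fin 2) ℂ) {δ : ℝ} (hW : ∀ e ∈ boxEdges 4 (2 * H + 1), ‖W e‖ ≤ δ)
    (p q : ↥(interiorSites H) × Fin 3) : |fpGen H W p q| ≤ 3 * δ * nbW (p.1 : Site 4) (q.1 : Site 4) := by
  have hδ : 0 ≤ δ := (norm_nonneg _).trans (hW _ (out_mem_boxEdges p.1.2 0))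
  rw [fpGen_apply_eq_sum, nbW, Finset.mul_sum]
  refine (Finset.abs_sum_le_sum_abs _ _).trans (Finset.sum_le_sum fun μ _ => ?_)
  set θ := basisField H q with hθ
  have hn : ∀ z : Site 4, ‖θ z‖ = if z = (q.1 : Site 4) then 1 else 0 := fun z => norm_basisField q z
  have hin : ‖linkLinM W θ ((p.1 : Site 4) - Pi.single μ 1, μ)‖ ≤
      3 * δ * (‖θ ((p.1 : Site 4) - Pi.single μ 1)‖ + ‖θ (p.1 : Site 4)‖) := by
    have h := norm_linkLinM_le W θ ((p.1 : Site 4) - Pi.single μ 1, μ)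
    dsimp only at h
    rw [sub_add_cancel] at h
    refine h.trans ?_
    have hWe := hW _ (in_mem_boxEdges p.1.2 μ)
    gcongr
  have hout : ‖linkLinM W θ ((p.1 : Site 4), μ)‖ ≤ 3 * δ * (‖θ (p.1 : Site 4)‖ + ‖θ ((p.1 : Site 4) + Pi.single μ 1)‖) := by
    have h := norm_linkLinM_le W θ ((p.1 : Site 4), μ)
    dsimp only at h
    refine h.trans ?_
    have hWe := hW _ (out_mem_boxEdges p.1.2 μ)
    gcongr
  calc |imVecM (linkLinM W θ ((p.1 : Site 4) - Pi.single μ 1, μ)) p.2 - imVecM (linkLinM W θ ((p.1 : Site 4), μ)) p.2|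
      ≤ |imVecM (linkLinM W θ ((p.1 : Site 4) - Pi.single μ 1, μ)) p.2| + |imVecM (linkLinM W θ ((p.1 : Site 4), μ)) p.2| :=
        abs_sub _ _
    _ ≤ ‖linkLinM W θ ((p.1 : Site 4) - Pi.single μ 1, μ)‖ + ‖linkLinM W θ ((p.1 : Site 4), μ)‖ :=
        add_le_add (abs_imVecM_le_norm _ _) (abs_imVecM_le_norm _ _)
    _ ≤ 3 * δ * (‖θ ((p.1 : Site 4) - Pi.single μ 1)‖ + ‖θ (p.1 : Site 4)‖) +
          3 * δ * (‖θ (p.1 : Site 4)‖ + ‖θ ((p.1 : Site 4) + Pi.single μ 1)‖) := add_le_add hin hout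
    _ = 3 * δ * ((if (p.1 : Site 4) - Pi.single μ 1 = (q.1 : Site 4) then (1 : ℝ) else 0) +
          (if (p.1 : Site 4) + Pi.single μ 1 = (q.1 : Site 4) then (1 : ℝ) else 0) +
          2 * (if (p.1 : Site 4) = (q.1 : Site 4) then (1 : ℝ) else 0)) := by
        rw [hn, hn, hn]; ring

/-- The entry bound for the DIFFERENCE of two `SU(2)` configurations (`‖↑(U e) − ↑(U' e)‖ ≤ δ` on the box links). -/
theorem abs_fpOperator_sub_le (U U' : LGConfig 4 SU2) {δ : ℝ}
    (hU : ∀ e ∈ boxEdges 4 (2 * H + 1), ‖(U e : Matrix (Fin 2) (Fin 2) ℂ) - (U' e : Matrix (Fin 2) (Fin 2) ℂ)‖ ≤ δ)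
    (p q : ↥(interiorSites H) × Fin 3) :
    |(fpOperator H U - fpOperator H U') p q| ≤ 3 * δ * nbW (p.1 : Site 4) (q.1 : Site 4) := by
  rw [fpOperator_eq_fpGen, fpOperator_eq_fpGen, ← fpGen_sub]
  exact abs_fpGen_le _ (fun e he => hU e he) p q

end GhostFP

end Summit.QuantumFields.YangMills.Theorems.AllWindowsColdBoxBoxHighLine

end
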